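import Summits.QuantumFields.YangMills.Theorems.UnitScaleTiltProp7HDsolAtRecordOfRows
import Summits.QuantumFields.YangMills.Theorems.UnitScaleTiltProp7StubEXOfChartPiecesTwS
import Literature.MathematicalPhysics.QuantumFieldTheory.Balaban1983to89.T3PrintedMinimiserExistence
import HarnessLib

/-!
# Route `UnitScaleTilt`, crux «MinimiserStabilityRegPr» (stmt-QuantumFields-19200, stub EX `stub_existenceMinimalOrbit`), route (α) — **JUNCTION `hΔsol` AT THE FAMILY LEVEL:
# THE DISPLAYED ROW `hΔsol` OF THE EX DISPLAY OF RECORD S9 (✓`Prop7StubEXOfChartPiecesTwS9`, p660931) VERBATIM — (136) + (140) for the (115)-piece `ιA₁ + ι(H₁B̃)` of THE solution of (111)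
# at the letters of record — FROM THE FOUR BACKGROUND-LEVEL OPERATOR ROWS OF RECORD {`hOpC`, `h137`, `hOp139`, `hOp349`} (★px5 g2 ✓`Prop7SectET3LandauOpRows`, ★px16 g2
# ✓`Prop7HDsolAtRecordOfRows.hΔsol_at_record_of_rows`), `hN06`, the letter rows `norm_G prop4 norm_H₁` and the knit's own windows `hrα hr4 hr16 hWe hWε`**, with the explicit
# `MΔ L := (1 + 25·C₄ L·B₀ L²) + cC L·(1 + 25·C₄ L·B₀ L²) + c137 L·2 + k139 L·(10 B₀ L)∕2 + 14·(10 B₀ L) + k349 L·(10 B₀ L)∕2 + 2·(10 B₀ L)` (the door by which a successor display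
# S10 := S9 with `hΔsol ↦ {hOpC, h137, hOp139, hOp349}` is a by-name composition; same three-step as `hSize19′` ✓p655784 → ✓p657727 → S8).

Cell `ym3-torus`, width seat `ym-ust-19200-w2` (gen 6; EX knit lineage ∕ EX letter namer).  THEOREMS ONLY (0 `def`, 0 `sorry`); `--supports stmt-QuantumFields-19200 --as helper`, count-neutral.
YM₃ on T³ is a ladder rung (R3), not the Clay problem; nothing here claims the stub, the crux, d = 4 or the mass gap.

THE PRINT.  [Balaban1985Variational] (128)–(136) + (140) pp. 297–299 (the second-order members of (19) for the solution of (111), «ε₂ = O(1)·C₁B₃ε₁»); [Balaban1985BackgroundPropagators] Thm 3.3,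
(3.49), (3.119)–(3.126), (3.153).  THE ROWS: the member texts of ✓`hΔsol_at_record_of_rows` ∕ ✓`secondOrder_of_eq111_opRows_rho` VERBATIM, quantified over the family `∀ L, 1 < L → ∀ (i : Idx L) U₀,
RegPr … (α L) U₀ → …` with the weights `c₀ L, cB L, a L i`: `hOpC` — Thm 3.3 + (3.49) for the `(1 − P₀*) + Landau-multiplier` term (generic `x`, Pi-norm right side); `h137` — the (137) block letter
(generic `Y`, SHARED with `h46₂`'s door ✓`Prop7H46TwoOfOpRowsFamily`); `hOp139` — (138) + «`G′RD*` bounded in |·|₍₁₎» (generic Landau `X`); `hOp349` — «`DPD*` bounded» (generic `X`).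
INHABITABILITY (★★OWNER RULING g27-№9 (3)): background-level operator sentences over landed Hilbert letters at `U₀ ∈ 𝔘_k(α)`; trivially true at `x = 0`∕`Y = 0`∕`X = 0`; finite-dimensional
at fixed `(F, K)`; content = `K`-uniform constants = the N06 storey (desk I-06); no solution letter in them.  Everything else this door reads is S9's own: the prefix (`0 < ε₁`, `PlaqSmall`,
`RegPr ρ`, `CloseAvg`, `ρ ≤ α L`), `hN06` (read at `α L` by ✓`regPr_mono`), `norm_G prop4 norm_H₁`, `hrα hr4 hr16` (⇒ Prop. 6's `h1 h2 h3`), `hWe hWε` (⇒ `L³ε₁ ≤ ½`, `ρ ≤ 1` by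
✓`windows_of_W` + ✓`windows_of_admissible`).

WHAT IS PROVED (ns `…Theorems.Prop7HDsolAtRecordOfRowsFamily`).  ★★★`hΔsol_of_opRows_family` — S9's binder `hΔsol` quantifier for quantifier with `MΔ L` as above, from the named rows; at each member
✓`hΔsol_at_record_of_rows` (★px16 g2).  ★`hMΔ_of_nonneg` — the display's `hMΔ : 0 ≤ MΔ L` from `0 ≤ cC L, c137 L, k139 L, k349 L` (displayed numerics).  HONEST SCOPE: by-name composition;
the four rows, `hN06`, `norm_G prop4 norm_H₁` stay DISPLAYED; the opaque `Wf` untouched.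

References: T. Bałaban, CMP 102 (1985) 277–309 [Balaban1985Variational] ((19) p.281, (111) p.294, Prop. 6 p.295, (128)–(140) pp.297–299); CMP 99 (1985) 389–434 [Balaban1985BackgroundPropagators]
(Thm 3.3 p.396, Thm 3.11 p.418, (3.49) p.399, (3.119)–(3.126) pp.419–420, (3.153) p.426).
-/

set_option autoImplicit false

noncomputable section

open scoped InnerProductSpace Matrix.Norms.L2Operator BigOperators

namespace Summit.QuantumFields.YangMills.Theorems.Prop7HDsolAtRecordOfRowsFamily

open Literature.MathematicalPhysics.QuantumFieldTheory.Balaban1983to89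
open Literature.MathematicalPhysics.QuantumFieldTheory.Balaban1983to89.T3ContinuumYM3Torus
open Literature.MathematicalPhysics.QuantumFieldTheory.Balaban1983to89.T3UnitLawDensityEML (ℰp)
open Literature.MathematicalPhysics.QuantumFieldTheory.Balaban1983to89.T3TiltDescent (descendTo)
open Literature.MathematicalPhysics.QuantumFieldTheory.Balaban1983to89.T3Thm1Carrier (Idx)
open Literature.MathematicalPhysics.QuantumFieldTheory.Balaban1983to89.T3PrintedRegularMinimiser (RegPr)
open Literature.MathematicalPhysics.QuantumFieldTheory.Balaban1983to89.T3PrintedMinimiserExistence (regPr_mono)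
open Literature.MathematicalPhysics.QuantumFieldTheory.Balaban1983to89.T3SectALandauChart (CloseAvg eta bgUnits covCodiffCurlT covLapFormT)
open B9SectCLatticeCarrier (Bond)
open B9Eq311L2Pairing (WL2)
open B11Eq115Space (NegSize Space115 JetSup NegSup)
open B11Eq111FrakG (nabla115)
open B11Eq98CurrentSlot (Jcur)
open B11Eq103H1Complex (BondL2K)
open B13Contraction113 (QuadAnalytic)
open MatrixLog (mlog)
open Summit.QuantumFields.YangMills.Theorems.Prop7SectET3Transport (periodsT3 bgOfCfg bondEquiv)
open Summit.QuantumFields.YangMills.Theorems.Prop7SectET3HilbertLetters (W₂ toL2 toL2B DL2 DstarL2)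
open Summit.QuantumFields.YangMills.Theorems.Prop7SectET3GaugeProjector (RS)
open Summit.QuantumFields.YangMills.Theorems.Prop7SectET3WilsonHessian (DeltaEta)
open Summit.QuantumFields.YangMills.Theorems.Prop7SectET3CurvedPropagators (Qk PosOnto GT KinvT H1f frakGfR)
open Summit.QuantumFields.YangMills.Theorems.Prop7SectET3DeltaPi (PosPrime GprimeT DeltaPiSlot)
open Summit.QuantumFields.YangMills.Theorems.Prop7StubEXOfChartPiecesTwS (windows_of_W)
open Summit.QuantumFields.YangMills.Theorems.Prop7StubEXOfChartPiecesTwL (windows_of_admissible three_le_memberL)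
open Summit.QuantumFields.YangMills.Theorems.Prop7HDsolAtRecordOfRows (hΔsol_at_record_of_rows)

variable [hFL : ∀ F : T3Family, Fact (0 < (F.L : ℝ))] [hFη : ∀ (F : T3Family) (k : ℕ), Fact (0 < ((F.L : ℝ)⁻¹) ^ k)]
variable {α : ℕ → ℝ} {c₀ cB : ℕ → ℝ} [hc₀ : ∀ L : ℕ, Fact (0 < c₀ L)] [hcB : ∀ L : ℕ, Fact (0 < cB L)] {a : ∀ L : ℕ, Idx L → ℝ}
  {ef B₀ C₄ a₃ r cC c137 k139 k349 : ℕ → ℝ}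

omit hFL hFη hc₀ hcB in
/-- ★ The display's `hMΔ : 0 ≤ MΔ L` for the explicit `MΔ` of this door, from the displayed numerics `0 ≤ cC L, c137 L, k139 L, k349 L` (and `0 < B₀ L, C₄ L`). [folklore] -/
theorem hMΔ_of_nonneg (hB₀ : ∀ L, 1 < L → 0 < B₀ L) (hC₄ : ∀ L, 1 < L → 0 < C₄ L)
    (hk : ∀ L, 1 < L → 0 ≤ cC L ∧ 0 ≤ c137 L ∧ 0 ≤ k139 L ∧ 0 ≤ k349 L) :
    ∀ L : ℕ, 1 < L → 0 ≤ ((1 + 25 * C₄ L * B₀ L ^ 2) + cC L * (1 + 25 * C₄ L * B₀ L ^ 2) + c137 L * 2 + k139 L * (10 * B₀ L) / 2 + 14 * (10 * B₀ L) + k349 L * (10 * B₀ L) / 2 + 2 * (10 * B₀ L)) := by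
  intro L hL
  obtain ⟨h1, h2, h3, h4⟩ := hk L hL
  have hB' := (hB₀ L hL).le
  have hC' := (hC₄ L hL).le
  positivity

/-- ★★★ **S9's ROW `hΔsol` — (136)+(140) FOR THE (115)-PIECE OF THE SOLUTION OF (111) AT THE LETTERS OF RECORD, FAMILY LEVEL, VERBATIM — FROM THE FOUR OPERATOR ROWS OF RECORD, `hN06`,
`norm_G prop4 norm_H₁` AND THE KNIT'S WINDOWS**, `MΔ L` explicit (✓`hΔsol_at_record_of_rows` at each member).
[cite: Balaban1985Variational, (128)–(136) pp.297–298, (140) p.299, (19)–(20) p.281, (111) p.294, Prop. 6 p.295; Balaban1985BackgroundPropagators, Thm 3.3 p.396, Thm 3.11 p.418, (3.49) p.399, (3.126) p.420, (3.153) p.426] -/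
theorem hΔsol_of_opRows_family (hα : ∀ L, 1 < L → 0 < α L) (hef : ∀ L, 1 < L → 0 < ef L)
    (hWe : ∀ L : ℕ, 1 < L → 10 ^ 9 * (L : ℝ) ^ 2 * ef L ≤ 1) (hWε : ∀ L : ℕ, 1 < L → 10 ^ 12 * (L : ℝ) ^ 3 * α L ≤ 1)
    (hB₀ : ∀ L, 1 < L → 0 < B₀ L) (hC₄ : ∀ L, 1 < L → 0 < C₄ L)
    (Wf : ∀ (L : ℕ) (i : Idx L) (U₀ : GaugeField (i.1.1.P i.1.2.2) 0 (Matrix.specialUnitaryGroup (Fin 2) ℂ)),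
      Space115 (i.1.1.L : ℝ) (((i.1.1.L : ℝ)⁻¹) ^ (i.1.2.2 - i.1.2.1)) (fun _ : Bond 3 (periodsT3 i.1.1 i.1.2.2) => i.1.2.2 - i.1.2.1)
          (fun _ : Bond 3 (periodsT3 i.1.1 i.1.2.2) × Fin 3 => i.1.2.2 - i.1.2.1) (nabla115 (((i.1.1.L : ℝ)⁻¹) ^ (i.1.2.2 - i.1.2.1)) (bgOfCfg i.1.1 i.1.2.2 U₀)) →
        NegSize (i.1.1.L : ℝ) (((i.1.1.L : ℝ)⁻¹) ^ (i.1.2.2 - i.1.2.1)) (fun _ : Bond 3 (periodsT3 i.1.1 i.1.2.2) => i.1.2.2 - i.1.2.1) 3 (Matrix (Fin 2) (Fin 2) ℂ))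
    (hN06 : ∀ (L : ℕ), 1 < L → ∀ (i : Idx L) (U₀ : GaugeField (i.1.1.P i.1.2.2) 0 (Matrix.specialUnitaryGroup (Fin 2) ℂ)), RegPr i.1.1 i.1.2.1 i.1.2.2 (α L) U₀ →
      PosOnto i.1.1 i.1.2.1 i.1.2.2 i.2.2.le (c₀ L) (cB L) (a L i) (DeltaPiSlot i.1.1 i.1.2.1 i.1.2.2 i.2.2.le (c₀ L) (cB L) (a L i)) U₀ ∧
      PosPrime i.1.1 i.1.2.1 i.1.2.2 i.2.2.le (c₀ L) (cB L) (a L i) U₀)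
    (norm_G : ∀ (L : ℕ), 1 < L → ∀ (i : Idx L) (ρ : ℝ) (U₀ : GaugeField (i.1.1.P i.1.2.2) 0 (Matrix.specialUnitaryGroup (Fin 2) ℂ)),
      RegPr i.1.1 i.1.2.1 i.1.2.2 ρ U₀ → ρ ≤ α L → ∀ f, ‖frakGfR i.1.1 i.1.2.1 i.1.2.2 i.2.2.le (c₀ L) (cB L) (a L i) (DeltaPiSlot i.1.1 i.1.2.1 i.1.2.2 i.2.2.le (c₀ L) (cB L) (a L i)) U₀ f‖ ≤ B₀ L * ‖f‖)
    (prop4 : ∀ (L : ℕ), 1 < L → ∀ (i : Idx L) (ρ : ℝ) (U₀ : GaugeField (i.1.1.P i.1.2.2) 0 (Matrix.specialUnitaryGroup (Fin 2) ℂ)),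
      RegPr i.1.1 i.1.2.1 i.1.2.2 ρ U₀ → ρ ≤ α L → QuadAnalytic (Wf L i U₀) (C₄ L) (a₃ L))
    (norm_H₁ : ∀ (L : ℕ), 1 < L → ∀ (i : Idx L) (ρ : ℝ) (U₀ : GaugeField (i.1.1.P i.1.2.2) 0 (Matrix.specialUnitaryGroup (Fin 2) ℂ)),
      RegPr i.1.1 i.1.2.1 i.1.2.2 ρ U₀ → ρ ≤ α L → ∀ b, ‖H1f i.1.1 i.1.2.1 i.1.2.2 i.2.2.le (c₀ L) (cB L) (a L i) (DeltaPiSlot i.1.1 i.1.2.1 i.1.2.2 i.2.2.le (c₀ L) (cB L) (a L i)) U₀ b‖ ≤ B₀ L * ‖b‖)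
    (hrα : ∀ L : ℕ, 1 < L → 2 * B₀ L * α L ≤ r L) (hr4 : ∀ L : ℕ, 1 < L → 4 * r L ≤ a₃ L) (hr16 : ∀ L : ℕ, 1 < L → 16 * B₀ L * C₄ L * r L ≤ 1)
    (hOpC : ∀ (L : ℕ), 1 < L → ∀ (i : Idx L) (U₀ : GaugeField (i.1.1.P i.1.2.2) 0 (Matrix.specialUnitaryGroup (Fin 2) ℂ)), RegPr i.1.1 i.1.2.1 i.1.2.2 (α L) U₀ →
      ∀ (x : BondL2K ℂ 3 (periodsT3 i.1.1 i.1.2.2) (c₀ L) W₂) (bd : PBond (i.1.1.P i.1.2.2) 0),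
        ‖(toL2 i.1.1 i.1.2.2 (c₀ L)).symm (LinearMap.adjoint (Qk i.1.1 i.1.2.1 i.1.2.2 i.2.2.le (c₀ L) (cB L) U₀) (KinvT i.1.1 i.1.2.1 i.1.2.2 i.2.2.le (c₀ L) (cB L) (a L i) (DeltaPiSlot i.1.1 i.1.2.1 i.1.2.2 i.2.2.le (c₀ L) (cB L) (a L i)) U₀
            (Qk i.1.1 i.1.2.1 i.1.2.2 i.2.2.le (c₀ L) (cB L) U₀ (GT i.1.1 i.1.2.1 i.1.2.2 i.2.2.le (c₀ L) (cB L) (a L i) (DeltaPiSlot i.1.1 i.1.2.1 i.1.2.2 i.2.2.le (c₀ L) (cB L) (a L i)) U₀ x)))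
            + DL2 i.1.1 i.1.2.1 i.1.2.2 (c₀ L) U₀ (RS i.1.1 i.1.2.1 i.1.2.2 i.2.2.le (c₀ L) (cB L) U₀ (DstarL2 i.1.1 i.1.2.1 i.1.2.2 (c₀ L) U₀ (GT i.1.1 i.1.2.1 i.1.2.2 i.2.2.le (c₀ L) (cB L) (a L i) (DeltaPiSlot i.1.1 i.1.2.1 i.1.2.2 i.2.2.le (c₀ L) (cB L) (a L i)) U₀ x)))) bd‖
          ≤ cC L * ‖(toL2 i.1.1 i.1.2.2 (c₀ L)).symm x‖)
    (h137 : ∀ (L : ℕ), 1 < L → ∀ (i : Idx L) (U₀ : GaugeField (i.1.1.P i.1.2.2) 0 (Matrix.specialUnitaryGroup (Fin 2) ℂ)), RegPr i.1.1 i.1.2.1 i.1.2.2 (α L) U₀ →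
      ∀ (Y : PBond (i.1.1.P i.1.2.1) 0 → Matrix (Fin 2) (Fin 2) ℂ) (b : PBond (i.1.1.P i.1.2.2) 0),
        ‖(toL2 i.1.1 i.1.2.2 (c₀ L)).symm (LinearMap.adjoint (Qk i.1.1 i.1.2.1 i.1.2.2 i.2.2.le (c₀ L) (cB L) U₀) (KinvT i.1.1 i.1.2.1 i.1.2.2 i.2.2.le (c₀ L) (cB L) (a L i) (DeltaPiSlot i.1.1 i.1.2.1 i.1.2.2 i.2.2.le (c₀ L) (cB L) (a L i)) U₀ (toL2B i.1.1 i.1.2.1 (cB L) Y))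
            - LinearMap.adjoint (Qk i.1.1 i.1.2.1 i.1.2.2 i.2.2.le (c₀ L) (cB L) U₀) (((a L i : ℂ)) • toL2B i.1.1 i.1.2.1 (cB L) Y)) b‖ ≤ c137 L * ‖Y‖)
    (hOp139 : ∀ (L : ℕ), 1 < L → ∀ (i : Idx L) (U₀ : GaugeField (i.1.1.P i.1.2.2) 0 (Matrix.specialUnitaryGroup (Fin 2) ℂ)), RegPr i.1.1 i.1.2.1 i.1.2.2 (α L) U₀ →
      ∀ (X : PBond (i.1.1.P i.1.2.2) 0 → Matrix (Fin 2) (Fin 2) ℂ) (s : ℝ), RS i.1.1 i.1.2.1 i.1.2.2 i.2.2.le (c₀ L) (cB L) U₀ (DstarL2 i.1.1 i.1.2.1 i.1.2.2 (c₀ L) U₀ (toL2 i.1.1 i.1.2.2 (c₀ L) X)) = 0 → (∀ bd, ‖X bd‖ ≤ s) →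
        ∀ bd : PBond (i.1.1.P i.1.2.2) 0, ‖(toL2 i.1.1 i.1.2.2 (c₀ L)).symm (LinearMap.adjoint
            (DL2 i.1.1 i.1.2.1 i.1.2.2 (c₀ L) U₀ ∘ₗ GprimeT i.1.1 i.1.2.1 i.1.2.2 i.2.2.le (c₀ L) (cB L) (a L i) U₀ ∘ₗ RS i.1.1 i.1.2.1 i.1.2.2 i.2.2.le (c₀ L) (cB L) U₀ ∘ₗ DstarL2 i.1.1 i.1.2.1 i.1.2.2 (c₀ L) U₀)
            (DeltaEta i.1.1 i.1.2.1 i.1.2.2 (c₀ L) U₀ (toL2 i.1.1 i.1.2.2 (c₀ L) X))) bd‖ ≤ k139 L * s)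
    (hOp349 : ∀ (L : ℕ), 1 < L → ∀ (i : Idx L) (U₀ : GaugeField (i.1.1.P i.1.2.2) 0 (Matrix.specialUnitaryGroup (Fin 2) ℂ)), RegPr i.1.1 i.1.2.1 i.1.2.2 (α L) U₀ →
      ∀ (X : PBond (i.1.1.P i.1.2.2) 0 → Matrix (Fin 2) (Fin 2) ℂ) (s : ℝ), (∀ bd, ‖X bd‖ ≤ s) → ∀ bd : PBond (i.1.1.P i.1.2.2) 0,
        ‖(toL2 i.1.1 i.1.2.2 (c₀ L)).symm (DL2 i.1.1 i.1.2.1 i.1.2.2 (c₀ L) U₀ (DstarL2 i.1.1 i.1.2.1 i.1.2.2 (c₀ L) U₀ (toL2 i.1.1 i.1.2.2 (c₀ L) X) - RS i.1.1 i.1.2.1 i.1.2.2 i.2.2.le (c₀ L) (cB L) U₀ (DstarL2 i.1.1 i.1.2.1 i.1.2.2 (c₀ L) U₀ (toL2 i.1.1 i.1.2.2 (c₀ L) X)))) bd‖ ≤ k349 L * s) :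
    ∀ (L : ℕ), 1 < L → ∀ (i : Idx L) (ε₁ : ℝ) (V : GaugeField (i.1.1.P i.1.2.1) 0 (Matrix.specialUnitaryGroup (Fin 2) ℂ))
      (U₀ : GaugeField (i.1.1.P i.1.2.2) 0 (Matrix.specialUnitaryGroup (Fin 2) ℂ)), 0 < ε₁ → PlaqSmall ε₁ V →
      RegPr i.1.1 i.1.2.1 i.1.2.2 ((L : ℝ) ^ 3 * (3 * (L : ℝ)) * ε₁) U₀ → CloseAvg i.1.1 i.1.2.1 i.1.2.2 i.2.2.le ((L : ℝ) ^ 3 * ε₁) V U₀ → (L : ℝ) ^ 3 * (3 * (L : ℝ)) * ε₁ ≤ α L →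
      ∀ A₁ : Space115 (i.1.1.L : ℝ) (((i.1.1.L : ℝ)⁻¹) ^ (i.1.2.2 - i.1.2.1)) (fun _ : Bond 3 (periodsT3 i.1.1 i.1.2.2) => i.1.2.2 - i.1.2.1)
          (fun _ : Bond 3 (periodsT3 i.1.1 i.1.2.2) × Fin 3 => i.1.2.2 - i.1.2.1) (nabla115 (((i.1.1.L : ℝ)⁻¹) ^ (i.1.2.2 - i.1.2.1)) (bgOfCfg i.1.1 i.1.2.2 U₀)),
        ‖A₁‖ < r L →
        A₁ + frakGfR i.1.1 i.1.2.1 i.1.2.2 i.2.2.le (c₀ L) (cB L) (a L i) (DeltaPiSlot i.1.1 i.1.2.1 i.1.2.2 i.2.2.le (c₀ L) (cB L) (a L i)) U₀ (Jcur (bgOfCfg i.1.1 i.1.2.2 U₀)) + frakGfR i.1.1 i.1.2.1 i.1.2.2 i.2.2.le (c₀ L) (cB L) (a L i) (DeltaPiSlot i.1.1 i.1.2.1 i.1.2.2 i.2.2.le (c₀ L) (cB L) (a L i)) U₀ (Wf L i U₀ (A₁ + H1f i.1.1 i.1.2.1 i.1.2.2 i.2.2.le (c₀ L) (cB L) (a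 L i) (DeltaPiSlot i.1.1 i.1.2.1 i.1.2.2 i.2.2.le (c₀ L) (cB L) (a L i)) U₀ (fun c : PBond (i.1.1.P i.1.2.1) 0 =>
          (-Complex.I) • mlog (((V c : Matrix.specialUnitaryGroup (Fin 2) ℂ) : Matrix (Fin 2) (Fin 2) ℂ)
            * star ((descendTo i.1.1 ℰp i.1.2.1 i.1.2.2 i.2.2.le U₀ c : Matrix.specialUnitaryGroup (Fin 2) ℂ) : Matrix (Fin 2) (Fin 2) ℂ))))) = 0 →
        (∀ (μ : Fin (i.1.1.P i.1.2.2).d) (x : Site (i.1.1.P i.1.2.2) 0),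
            ‖covCodiffCurlT 1 (bgUnits i.1.1 i.1.2.2 U₀) ((fun b : PBond (i.1.1.P i.1.2.2) 0 => JetSup.equiv _ _ _ A₁ (bondEquiv i.1.1 i.1.2.2 b))
            + (fun b : PBond (i.1.1.P i.1.2.2) 0 => JetSup.equiv _ _ _ (H1f i.1.1 i.1.2.1 i.1.2.2 i.2.2.le (c₀ L) (cB L) (a L i) (DeltaPiSlot i.1.1 i.1.2.1 i.1.2.2 i.2.2.le (c₀ L) (cB L) (a L i)) U₀ (fun c : PBond (i.1.1.P i.1.2.1) 0 =>
          (-Complex.I) • mlog (((V c : Matrix.specialUnitaryGroup (Fin 2) ℂ) : Matrix (Fin 2) (Fin 2) ℂ)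
            * star ((descendTo i.1.1 ℰp i.1.2.1 i.1.2.2 i.2.2.le U₀ c : Matrix.specialUnitaryGroup (Fin 2) ℂ) : Matrix (Fin 2) (Fin 2) ℂ)))) (bondEquiv i.1.1 i.1.2.2 b))) μ x‖ ≤ ((1 + 25 * C₄ L * B₀ L ^ 2) + cC L * (1 + 25 * C₄ L * B₀ L ^ 2) + c137 L * 2 + k139 L * (10 * B₀ L) / 2 + 14 * (10 * B₀ L) + k349 L * (10 * B₀ L) / 2 + 2 * (10 * B₀ L)) * ((L : ℝ) ^ 3 * (3 * (L : ℝ)) * ε₁) * eta i.1.1 i.1.2.1 i.1.2.2 ^ 2) ∧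
          (∀ (ν : Fin (i.1.1.P i.1.2.2).d) (x : Site (i.1.1.P i.1.2.2) 0),
            ‖covLapFormT 1 (bgUnits i.1.1 i.1.2.2 U₀) ((fun b : PBond (i.1.1.P i.1.2.2) 0 => JetSup.equiv _ _ _ A₁ (bondEquiv i.1.1 i.1.2.2 b))
            + (fun b : PBond (i.1.1.P i.1.2.2) 0 => JetSup.equiv _ _ _ (H1f i.1.1 i.1.2.1 i.1.2.2 i.2.2.le (c₀ L) (cB L) (a L i) (DeltaPiSlot i.1.1 i.1.2.1 i.1.2.2 i.2.2.le (c₀ L) (cB L) (a L i)) U₀ (fun c : PBond (i.1.1.P i.1.2.1) 0 =>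
          (-Complex.I) • mlog (((V c : Matrix.specialUnitaryGroup (Fin 2) ℂ) : Matrix (Fin 2) (Fin 2) ℂ)
            * star ((descendTo i.1.1 ℰp i.1.2.1 i.1.2.2 i.2.2.le U₀ c : Matrix.specialUnitaryGroup (Fin 2) ℂ) : Matrix (Fin 2) (Fin 2) ℂ)))) (bondEquiv i.1.1 i.1.2.2 b))) ν x‖ ≤ ((1 + 25 * C₄ L * B₀ L ^ 2) + cC L * (1 + 25 * C₄ L * B₀ L ^ 2) + c137 L * 2 + k139 L * (10 * B₀ L) / 2 + 14 * (10 * B₀ L) + k349 L * (10 * B₀ L) / 2 + 2 * (10 * B₀ L)) * ((L : ℝ) ^ 3 * (3 * (L : ℝ)) * ε₁) * eta i.1.1 i.1.2.1 i.1.2.2 ^ 2) := by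
  intro L hL i ε₁ V U₀ hε₁ _hV hreg hclose hαe A₁ hA₁ hsol
  have hFL' : (i.1.1.L : ℝ) = (L : ℝ) := by exact_mod_cast i.2.1
  have hL1 : (1 : ℝ) ≤ (L : ℝ) := by exact_mod_cast hL.le
  have hL3 : (3 : ℝ) ≤ (L : ℝ) := by rw [← hFL']; exact three_le_memberL i
  obtain ⟨s3, -⟩ := windows_of_W hL3 (hα L hL).le (hef L hL).le (hWe L hL) (hWε L hL)
  obtain ⟨hwinL, -, hα16⟩ := windows_of_admissible hL1 hε₁.le hαe s3
  have hregα : RegPr i.1.1 i.1.2.1 i.1.2.2 (α L) U₀ := regPr_mono i.1.1 hαe hreg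
  obtain ⟨hp, hq⟩ := hN06 L hL i U₀ hregα
  have hreg' : RegPr i.1.1 i.1.2.1 i.1.2.2 ((i.1.1.L : ℝ) ^ 3 * (3 * (i.1.1.L : ℝ)) * ε₁) U₀ := by rw [hFL']; exact hreg
  have hclose' : CloseAvg i.1.1 i.1.2.1 i.1.2.2 i.2.2.le ((i.1.1.L : ℝ) ^ 3 * ε₁) V U₀ := by rw [hFL']; exact hclose
  have hwin : (i.1.1.L : ℝ) ^ 3 * ε₁ ≤ 1 / 2 := by rw [hFL']; exact hwinL
  have hρ1 : (i.1.1.L : ℝ) ^ 3 * (3 * (i.1.1.L : ℝ)) * ε₁ ≤ 1 := by rw [hFL']; linarith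
  have hB0 : 0 < B₀ L := hB₀ L hL
  have hρα : (i.1.1.L : ℝ) ^ 3 * (3 * (i.1.1.L : ℝ)) * ε₁ ≤ α L := by rw [hFL']; exact hαe
  have h1 : 2 * B₀ L * (i.1.1.L : ℝ) ^ 3 * (3 * (i.1.1.L : ℝ)) * ε₁ ≤ r L := by
    nlinarith [hrα L hL, mul_le_mul_of_nonneg_left hρα hB0.le]
  have hmem := hΔsol_at_record_of_rows i.1.1 i.1.2.1 i.1.2.2 i.2.2.le U₀ V (Wf L i U₀) hB0 (hC₄ L hL) hε₁ hreg' hclose' hwin hρ1 hp hq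
    (norm_G L hL i _ U₀ hreg hαe) (prop4 L hL i _ U₀ hreg hαe) (norm_H₁ L hL i _ U₀ hreg hαe) h1 (hr4 L hL) (hr16 L hL)
    (hOpC L hL i U₀ hregα) (h137 L hL i U₀ hregα) (hOp139 L hL i U₀ hregα) (hOp349 L hL i U₀ hregα) A₁ hA₁ hsol
  refine ⟨fun μ x => (hmem.1 μ x).trans_eq ?_, fun ν x => (hmem.2 ν x).trans_eq ?_⟩ <;> rw [hFL']

end Summit.QuantumFields.YangMills.Theorems.Prop7HDsolAtRecordOfRowsFamily

end
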